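import Literature.AlgebraicGeometry.Morphisms.CotangentRankOfDualNumberLifts
import Literature.AlgebraicGeometry.Dimension.CotangentDimensionOfOpenPiece
import Literature.AlgebraicGeometry.Motives.BaseChange
import Mathlib.RingTheory.DualNumber
import Mathlib.AlgebraicGeometry.AlgClosed.Basic
import HarnessLib

/-!
# Relative dimension LIFTS along a morphism that lifts `ℂ[ε]`-points: base change `k → ℂ` of the lifting, and the piece inequality
# (Görtz–Wedhorn I (6.4) Prop. 6.7, (4.11); sequel of ★ `Morphisms/CotangentRankOfDualNumberLifts`)

Topic `Literature/AlgebraicGeometry/Morphisms`.  THEOREMS ONLY (no definition, no named fact, no instance, no `sorry`).  Generic,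
consumer-agnostic; in the cell `hodgecm-mathlib` (D-0151) this is (R4-δ) of the Hecke-link line of SOCKETS-F §4 (α) (B-plan1 (g14)
ruling 2026-08-29T19:31:36Z (1): socket (A) binder `TrLiftsRelDim`), whose Siegel instantiation is
`ModuliOfAbelianVarieties/SiegelModuliTowerLiftsRelDim` (consumer: the `hLift` hypothesis of ★ `EquidimThickLift.exists_lift_le_relDim`).
HC_CM is proved only modulo the 7 printed citations until rung 0 closes.

* §1 `Motives.dualNumber_lifts_baseChange` — GENERIC TRANSPORT.  Let `t : M ⟶ M′` be a morphism of `k`-schemes (`k` a field with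
  `k → ℂ`) that LIFTS `ℂ[ε]`-POINTS OVER `k` in the «γ-form»: whenever `pt ≫ τ = s′ ≫ t` for `k`-morphisms `s′ : Spec ℂ → M`,
  `τ : Spec ℂ[ε] → M′` and the closed point `pt : Spec ℂ → Spec ℂ[ε]`, there is `σ : Spec ℂ[ε] → M` over `k` with `pt ≫ σ = s′`
  and `σ ≫ t = τ`.  Then the base change `t_ℂ : M_ℂ ⟶ M′_ℂ` lifts `ℂ[ε]`-points OVER `ℂ`, CENTRED (the «β-form» consumed by ★
  `finrank_cotangentSpace_le_of_dualNumber_lifts`): every `ℂ`-morphism `τ : Spec ℂ[ε] → M′_ℂ` whose closed point is `t_ℂ x₀` for a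
  `ℂ`-point `x₀` of `M_ℂ` is `σ ≫ t_ℂ` with `σ` centred at `x₀` — by the universal property of `M_ℂ = M ×_k Spec ℂ` (Mathlib
  `pullback.lift`/`pullback.hom_ext`, ★ `Motives.baseChangeHom_map_left_comp_fst`) and «a `ℂ`-point over `ℂ` of a scheme locally of
  finite type over `ℂ` is determined by its closed point» (Mathlib `ext_of_apply_closedPoint_eq`), which identifies the `ℂ`-points
  `pt ≫ τ` and `x₀ ≫ t_ℂ` of `M′_ℂ`.
* §2 `Morphisms.relDim_le_of_dualNumber_lifts` — THE PIECE INEQUALITY.  `p : X ⟶ Y` a `ℂ`-morphism of smooth `ℂ`-schemes, open pieces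
  `ι″ : S″ ⟶ X`, `ι : S′ ⟶ Y` smooth of relative dimensions `d″`, `d`, `ℂ`-points `s″`, `s` with `s″ ≫ ι″ ≫ p = s ≫ ι`: if the
  `ℂ[ε]`-points of `Y` centred at `p (ι″ s″)` lift along `p` centred at `ι″ s″`, then `d ≤ d″` — ★ (R4-β) gives
  `dim 𝔪_{p x}/𝔪_{p x}² ≤ dim 𝔪_x/𝔪_x²` at `x = ι″ s″`, and the two cotangent dimensions are `d` and `d″` (★
  `Dimension.finrank_cotangentSpace_stalk_eq_of_isOpenImmersion_of_isClosed'`).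
The file uses `set_option backward.isDefEq.respectTransparency false` (as the ★ `Motives/*BaseChange*` files do) for the
definitional identifications `(M_ℂ).left = pullback M.hom (Spec ℂ → Spec k)`, `(M_ℂ).hom = pullback.snd`.

## References
* [GortzWedhorn2020] U. Görtz, T. Wedhorn, *Algebraic Geometry I* (2nd ed. 2020): (6.4) Def. 6.2 / Prop. 6.7 (tangent spaces as
  `k[ε]`-points, functoriality of `T_x`), (4.11) and (5.2) (base change; points with values in a ring), Cor. 3.36, Thm. 6.28.
* [StacksProject] The Stacks Project, Tag 0B2C / 0B2E (tangent spaces and their functoriality), Tag 01JW (base change).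
-/

set_option autoImplicit false
set_option backward.isDefEq.respectTransparency false

noncomputable section

open CategoryTheory CategoryTheory.Limits AlgebraicGeometry TopologicalSpace IsLocalRing
open scoped DualNumber

/-! ### §1 Generic transport: `t` lifts `ℂ[ε]`-points over `k` ⇒ `t_ℂ` lifts `ℂ[ε]`-points over `ℂ`, centred -/

namespace Literature.AlgebraicGeometry.Motives

variable {k : Type} [Field k] [Algebra k ℂ]

/-- The projection `fst : ℂ[ε] → ℂ` is a local homomorphism (a dual number is a unit iff its constant part is).
[cite: GortzWedhorn2020, (6.4)] -/
theorem isLocalHom_fstHom_dualNumber :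
    IsLocalHom (CommRingCat.ofHom (TrivSqZeroExt.fstHom ℂ ℂ ℂ).toRingHom).hom :=
  ⟨fun _ h => TrivSqZeroExt.isUnit_iff_isUnit_fst.mpr h⟩

/-- **Base change of `ℂ[ε]`-liftings.**  Let `t : M ⟶ M′` be a morphism of `k`-schemes (`k` a field inside `ℂ`) which LIFTS
`ℂ[ε]`-POINTS OVER `k`: whenever `pt ≫ τ = s′ ≫ t` for `s′ : Spec ℂ → M`, `τ : Spec ℂ[ε] → M′` over `k` and the closed point
`pt : Spec ℂ → Spec ℂ[ε]`, there is `σ : Spec ℂ[ε] → M` over `k` with `pt ≫ σ = s′` and `σ ≫ t = τ`.  Then the base change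
`t_ℂ : M_ℂ ⟶ M′_ℂ` lifts `ℂ[ε]`-points OVER `ℂ`, centred: every `ℂ`-morphism `τ : Spec ℂ[ε] → M′_ℂ` whose closed point is
`t_ℂ(x₀)` for a `ℂ`-point `x₀` of `M_ℂ` is `σ ≫ t_ℂ` with `σ` centred at `x₀` (universal property of `M_ℂ = M ×_k Spec ℂ`; the
`ℂ`-point `pt ≫ τ` of `M′_ℂ` equals `x₀ ≫ t_ℂ` because both have the same closed point).
[cite: GortzWedhorn2020, (4.11) and (6.4) Prop. 6.7] -/
theorem dualNumber_lifts_baseChange {M M' : SchemeOver k} (t : M ⟶ M')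
    (hγ : ∀ (pt : specOver k ℂ ⟶ specOver k ℂ[ε])
      (_ : pt.left = Spec.map (CommRingCat.ofHom (TrivSqZeroExt.fstHom ℂ ℂ ℂ).toRingHom))
      (s' : specOver k ℂ ⟶ M) (τ : specOver k ℂ[ε] ⟶ M'),
      pt ≫ τ = s' ≫ t → ∃ σ : specOver k ℂ[ε] ⟶ M, pt ≫ σ = s' ∧ σ ≫ t = τ)
    [LocallyOfFiniteType ((baseChange k ℂ).obj M').hom]
    (x₀ : specOver ℂ ℂ ⟶ (baseChange k ℂ).obj M) (τ : specOver ℂ ℂ[ε] ⟶ (baseChange k ℂ).obj M')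
    (hτ : τ.left.base (closedPoint ℂ[ε]) = ((baseChange k ℂ).map t).left.base (x₀.left.base (closedPoint ℂ))) :
    ∃ σ : specOver ℂ ℂ[ε] ⟶ (baseChange k ℂ).obj M,
      σ.left.base (closedPoint ℂ[ε]) = x₀.left.base (closedPoint ℂ) ∧ σ ≫ (baseChange k ℂ).map t = τ := by
  -- notation: the base field extension `F : Spec ℂ → Spec k` and the two fibre products
  set F : Spec (.of ℂ) ⟶ Spec (.of k) := Spec.map (CommRingCat.ofHom (algebraMap k ℂ)) with hF
  haveI : IsLocalHom (CommRingCat.ofHom (TrivSqZeroExt.fstHom ℂ ℂ ℂ).toRingHom).hom := isLocalHom_fstHom_dualNumber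
  have hMl : ((baseChange k ℂ).obj M).left = pullback M.hom F := rfl
  have hM'l : ((baseChange k ℂ).obj M').left = pullback M'.hom F := rfl
  have hMh : ((baseChange k ℂ).obj M).hom = pullback.snd M.hom F := rfl
  have hM'h : ((baseChange k ℂ).obj M').hom = pullback.snd M'.hom F := rfl
  have htfst : ((baseChange k ℂ).map t).left ≫ pullback.fst M'.hom F = pullback.fst M.hom F ≫ t.left :=
    baseChangeHom_map_left_comp_fst (algebraMap k ℂ) t
  have htsnd : ((baseChange k ℂ).map t).left ≫ pullback.snd M'.hom F = pullback.snd M.hom F := by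
    rw [← hM'h, ← hMh]; exact Over.w ((baseChange k ℂ).map t)
  -- ring-level identities
  have hεk : (TrivSqZeroExt.fstHom ℂ ℂ ℂ).toRingHom.comp (algebraMap k ℂ[ε]) = algebraMap k ℂ := by
    ext c; simp
  have hεℂ : (TrivSqZeroExt.fstHom ℂ ℂ ℂ).toRingHom.comp (algebraMap ℂ ℂ[ε]) = RingHom.id ℂ := by
    ext c; simp
  have htow : algebraMap k ℂ[ε] = (algebraMap ℂ ℂ[ε]).comp (algebraMap k ℂ) := IsScalarTower.algebraMap_eq k ℂ ℂ[ε]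
  have hidℂ : Spec.map (CommRingCat.ofHom (algebraMap ℂ ℂ)) = 𝟙 (Spec (.of ℂ)) := by
    rw [Algebra.algebraMap_self]; exact Spec.map_id _
  -- the closed point over `ℂ` and over `k`
  have hptℂw : Spec.map (CommRingCat.ofHom (TrivSqZeroExt.fstHom ℂ ℂ ℂ).toRingHom) ≫ (specOver ℂ ℂ[ε]).hom =
      (specOver ℂ ℂ).hom := by
    change Spec.map _ ≫ Spec.map _ = Spec.map _
    rw [← Spec.map_comp, ← CommRingCat.ofHom_comp, hεℂ, Algebra.algebraMap_self]
  let ptℂ : specOver ℂ ℂ ⟶ specOver ℂ ℂ[ε] :=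
    Over.homMk (Spec.map (CommRingCat.ofHom (TrivSqZeroExt.fstHom ℂ ℂ ℂ).toRingHom)) hptℂw
  have hptkw : Spec.map (CommRingCat.ofHom (TrivSqZeroExt.fstHom ℂ ℂ ℂ).toRingHom) ≫ (specOver k ℂ[ε]).hom =
      (specOver k ℂ).hom := by
    change Spec.map _ ≫ Spec.map _ = Spec.map _
    rw [← Spec.map_comp, ← CommRingCat.ofHom_comp, hεk]
  let ptk : specOver k ℂ ⟶ specOver k ℂ[ε] :=
    Over.homMk (Spec.map (CommRingCat.ofHom (TrivSqZeroExt.fstHom ℂ ℂ ℂ).toRingHom)) hptkw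
  -- the `k`-side shadows of `τ` and `x₀`
  have hτkw : (τ.left ≫ pullback.fst M'.hom F) ≫ M'.hom = (specOver k ℂ[ε]).hom := by
    rw [Category.assoc, pullback.condition, ← Category.assoc, ← hM'h, Over.w τ]
    change Spec.map _ ≫ Spec.map _ = Spec.map _
    rw [← Spec.map_comp, ← CommRingCat.ofHom_comp, ← htow]
  let τk : specOver k ℂ[ε] ⟶ M' := Over.homMk (τ.left ≫ pullback.fst M'.hom F) hτkw
  have hskw : (x₀.left ≫ pullback.fst M.hom F) ≫ M.hom = (specOver k ℂ).hom := by
    rw [Category.assoc, pullback.condition, ← Category.assoc, ← hMh, Over.w x₀]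
    change Spec.map _ ≫ Spec.map _ = Spec.map _
    rw [← Spec.map_comp, ← CommRingCat.ofHom_comp, Algebra.algebraMap_self, RingHom.id_comp]
  let sk : specOver k ℂ ⟶ M := Over.homMk (x₀.left ≫ pullback.fst M.hom F) hskw
  -- the `ℂ`-points `pt ≫ τ` and `x₀ ≫ t_ℂ` of `M′_ℂ` coincide (same closed point)
  have hpts : Spec.map (CommRingCat.ofHom (TrivSqZeroExt.fstHom ℂ ℂ ℂ).toRingHom) ≫ τ.left =
      x₀.left ≫ ((baseChange k ℂ).map t).left := by
    refine ext_of_apply_closedPoint_eq ((baseChange k ℂ).obj M').hom ?_ ?_ ?_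
    · rw [Category.assoc, Over.w τ]
      change Spec.map _ ≫ Spec.map _ = 𝟙 _
      rw [← Spec.map_comp, ← CommRingCat.ofHom_comp, hεℂ]
      exact Spec.map_id _
    · rw [Category.assoc, Over.w ((baseChange k ℂ).map t), Over.w x₀]
      exact hidℂ
    · rw [Scheme.Hom.comp_apply, Scheme.Hom.comp_apply, Spec_closedPoint]
      exact hτ
  -- the hypothesis of `hγ`
  have hk : ptk ≫ τk = sk ≫ t := by
    apply Over.OverMorphism.ext
    change Spec.map (CommRingCat.ofHom (TrivSqZeroExt.fstHom ℂ ℂ ℂ).toRingHom) ≫ τ.left ≫ pullback.fst M'.hom F =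
      (x₀.left ≫ pullback.fst M.hom F) ≫ t.left
    rw [← Category.assoc, hpts, Category.assoc, htfst, Category.assoc]
  obtain ⟨σ', hσ'₁, hσ'₂⟩ := hγ ptk rfl sk τk hk
  -- the lift over `ℂ`
  have hσw : σ'.left ≫ M.hom = Spec.map (CommRingCat.ofHom (algebraMap ℂ ℂ[ε])) ≫ F := by
    rw [Over.w σ', hF, ← Spec.map_comp, ← CommRingCat.ofHom_comp, ← htow]
    rfl
  have hσw' : pullback.lift σ'.left (Spec.map (CommRingCat.ofHom (algebraMap ℂ ℂ[ε]))) hσw ≫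
      ((baseChange k ℂ).obj M).hom = (specOver ℂ ℂ[ε]).hom := by
    rw [hMh, pullback.lift_snd]
    rfl
  let σ : specOver ℂ ℂ[ε] ⟶ (baseChange k ℂ).obj M :=
    Over.homMk (pullback.lift σ'.left (Spec.map (CommRingCat.ofHom (algebraMap ℂ ℂ[ε]))) hσw) hσw'
  have hσl : σ.left = pullback.lift σ'.left (Spec.map (CommRingCat.ofHom (algebraMap ℂ ℂ[ε]))) hσw := rfl
  refine ⟨σ, ?_, ?_⟩
  · -- centred at `x₀`: `ptℂ ≫ σ = x₀`
    have hptσ : Spec.map (CommRingCat.ofHom (TrivSqZeroExt.fstHom ℂ ℂ ℂ).toRingHom) ≫ σ.left = x₀.left := by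
      rw [hσl]
      apply pullback.hom_ext
      · rw [Category.assoc, pullback.lift_fst]
        have h1 := congrArg CommaMorphism.left hσ'₁
        exact h1
      · rw [Category.assoc, pullback.lift_snd, ← hMh, Over.w x₀]
        change Spec.map _ ≫ Spec.map _ = Spec.map _
        rw [← Spec.map_comp, ← CommRingCat.ofHom_comp, hεℂ, Algebra.algebraMap_self]
    have h2 := congrArg (fun q : Spec (.of ℂ) ⟶ ((baseChange k ℂ).obj M).left => q.base (closedPoint ℂ)) hptσ
    rw [Scheme.Hom.comp_apply, Spec_closedPoint] at h2
    exact h2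
  · -- `σ ≫ t_ℂ = τ`
    apply Over.OverMorphism.ext
    change σ.left ≫ ((baseChange k ℂ).map t).left = τ.left
    rw [hσl]
    apply pullback.hom_ext
    · rw [Category.assoc, htfst, ← Category.assoc, pullback.lift_fst]
      exact congrArg CommaMorphism.left hσ'₂
    · rw [Category.assoc, htsnd, pullback.lift_snd, ← hM'h, Over.w τ]
      rfl

end Literature.AlgebraicGeometry.Motives

/-! ### §2 Generic piece inequality: `ℂ[ε]`-points lift along `p` at `ι″ s″` ⇒ `d ≤ d″` -/

namespace Literature.AlgebraicGeometry.Morphisms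

open Literature.AlgebraicGeometry.Motives (SchemeOver specOver ComplexPoints)

/-- A `ℂ`-point of a `ℂ`-scheme is a section of the structure morphism. [cite: GortzWedhorn2020, Cor. 3.36] -/
theorem complexPoint_left_comp_hom {S : SchemeOver ℂ} (s : ComplexPoints S) : s.left ≫ S.hom = 𝟙 _ := by
  rw [Over.w s]
  change Spec.map (CommRingCat.ofHom (algebraMap ℂ ℂ)) = 𝟙 _
  rw [Algebra.algebraMap_self]; exact Spec.map_id _

/-- The image of a `ℂ`-point of a `ℂ`-scheme locally of finite type is a closed point. [cite: GortzWedhorn2020, Cor. 3.36] -/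
theorem isClosed_singleton_complexPoint {S : SchemeOver ℂ} [LocallyOfFiniteType S.hom] (s : ComplexPoints S) :
    IsClosed ({s.left.base (closedPoint ℂ)} : Set S.left) := by
  have := (pointEquivClosedPoint S.hom ⟨s.left, complexPoint_left_comp_hom s⟩).2
  rw [pointEquivClosedPoint_apply_coe, mem_closedPoints_iff] at this
  exact this

/-- **`ℂ[ε]`-points lift along `p` at `ι″ s″` ⇒ `d ≤ d″` for smooth open pieces through `ι″ s″` and `p (ι″ s″)`.**  With
`p : X ⟶ Y` a `ℂ`-morphism of smooth `ℂ`-schemes, open pieces `ι″ : S″ ⟶ X`, `ι : S′ ⟶ Y` smooth of relative dimensions `d″`, `d`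
and `ℂ`-points `s″`, `s` with `s″ ≫ ι″ ≫ p = s ≫ ι`: the cotangent dimensions at `x = ι″ s″` and `p x = ι s` are `d″` and `d`
(★-ready `Dimension.finrank_cotangentSpace_stalk_eq_of_isOpenImmersion_of_isClosed'`), and the lifting gives
`dim 𝔪_{p x}/𝔪_{p x}² ≤ dim 𝔪_x/𝔪_x²` ((R4-β)). [cite: GortzWedhorn2020, (6.4) Prop. 6.7 and Thm. 6.28] -/
theorem relDim_le_of_dualNumber_lifts {X Y : SchemeOver ℂ} (p : X ⟶ Y) [Smooth X.hom] [Smooth Y.hom]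
    {S'' : SchemeOver ℂ} (ι'' : S'' ⟶ X) [IsOpenImmersion ι''.left] (d'' : ℕ) [SmoothOfRelativeDimension d'' S''.hom]
    {S' : SchemeOver ℂ} (ι : S' ⟶ Y) [IsOpenImmersion ι.left] (d : ℕ) [SmoothOfRelativeDimension d S'.hom]
    (s'' : ComplexPoints S'') (s : ComplexPoints S') (h : s'' ≫ ι'' ≫ p = s ≫ ι)
    (hlift : ∀ τ : specOver ℂ ℂ[ε] ⟶ Y, τ.left.base (closedPoint ℂ[ε]) = p.left.base ((s'' ≫ ι'').left.base (closedPoint ℂ)) →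
      ∃ σ : specOver ℂ ℂ[ε] ⟶ X, σ.left.base (closedPoint ℂ[ε]) = (s'' ≫ ι'').left.base (closedPoint ℂ) ∧ σ ≫ p = τ) :
    d ≤ d'' := by
  haveI : Smooth S''.hom := SmoothOfRelativeDimension.smooth d'' _
  haveI : Smooth S'.hom := SmoothOfRelativeDimension.smooth d _
  haveI : LocallyOfFiniteType S''.hom := inferInstance
  haveI : LocallyOfFiniteType S'.hom := inferInstance
  haveI : LocallyOfFiniteType X.hom := inferInstance
  haveI : LocallyOfFiniteType Y.hom := inferInstance
  have hX : X.hom = p.left ≫ Y.hom := (Over.w p).symm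
  haveI : LocallyOfFiniteType p.left := by
    have : LocallyOfFiniteType (p.left ≫ Y.hom) := by rw [← hX]; infer_instance
    exact locallyOfFiniteType_of_comp p.left Y.hom
  haveI : SmoothOfRelativeDimension d'' (ι''.left ≫ X.hom) := by rw [Over.w ι'']; infer_instance
  haveI : SmoothOfRelativeDimension d (ι.left ≫ Y.hom) := by rw [Over.w ι]; infer_instance
  -- the points
  have hy'' : IsClosed ({s''.left.base (closedPoint ℂ)} : Set S''.left) := isClosed_singleton_complexPoint s''
  have hy' : IsClosed ({s.left.base (closedPoint ℂ)} : Set S'.left) := isClosed_singleton_complexPoint s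
  have hx : (s'' ≫ ι'').left.base (closedPoint ℂ) = ι''.left.base (s''.left.base (closedPoint ℂ)) := by
    rw [Over.comp_left, Scheme.Hom.comp_apply]
  have hxc : IsClosed ({(s'' ≫ ι'').left.base (closedPoint ℂ)} : Set X.left) := isClosed_singleton_complexPoint (s'' ≫ ι'')
  have hpx : p.left.base ((s'' ≫ ι'').left.base (closedPoint ℂ)) = ι.left.base (s.left.base (closedPoint ℂ)) := by
    rw [← Scheme.Hom.comp_apply, ← Over.comp_left, ← Scheme.Hom.comp_apply, ← Over.comp_left, Category.assoc, h,
      Over.comp_left, Scheme.Hom.comp_apply]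
  -- (R4-β) at `x = ι″ s″`
  have hle := finrank_cotangentSpace_le_of_dualNumber_lifts p ((s'' ≫ ι'').left.base (closedPoint ℂ)) hxc hlift
  rw [hpx, hx, Literature.AlgebraicGeometry.Dimension.finrank_cotangentSpace_stalk_eq_of_isOpenImmersion_of_isClosed'
      Y.hom ι.left d hy',
    Literature.AlgebraicGeometry.Dimension.finrank_cotangentSpace_stalk_eq_of_isOpenImmersion_of_isClosed'
      X.hom ι''.left d'' hy''] at hle
  exact hle

end Literature.AlgebraicGeometry.Morphisms

end
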